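import Literature.Topology.FourManifolds.LickorishWallaceProofs
import Literature.Topology.FourManifolds.RegularLevelSplitting
import HarnessLib

/-!
# Sublevel sets below the `2`-handles are connected; boundaries of the components of a
# manifold built from handles of index `≥ 2` over its boundary

Topic `Literature/Topology/FourManifolds`; infrastructure for the fact seat
`provefact-Literature.Topology.FourManifolds.exists_isBalancedGKTrisection` (Gay–Kirby 2016,
Thm. 4 via §4, Lemma 14: the handlebodies `H₁₂ = {φ ≤ b}`, `H₃₁ = {b ≤ φ}` of a Heegaard
function `φ` on the `3`-manifold `∂X₁` that is *ordered* — critical points of index `≤ 1`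
below `b`, of index `≥ 2` above — but not self-indexing, so that the tree's connectedness
criterion `RegularSublevel.connectedSpace` (at most one minimum, Reeb) does not apply).
Everything in this file is **proved**; no definitions, no named facts.

* `IsMorseAdapted.isPreconnected_connectedComponent_inter_boundary` — **on a compact manifold
  with boundary carrying a Morse function adapted to the boundary all of whose critical points
  have coindex `≥ 2`, every connected component meets the boundary in a (pre)connected set.**
  This is the tree's `IsMorseAdapted.isPreconnected_boundary_and_nonempty` (F2a of the
  Lickorish–Wallace DAG, `LickorishWallaceProofs.lean`: "the boundary of a handlebody is
  connected") with the connectedness hypothesis moved from the manifold to a component: the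
  topological engine `isPreconnected_preimage_top_of_joinedIn` is run on the component, a
  compact connected locally path-connected open-and-closed subspace, the local joining data at
  interior points (`localJoin_of_not_isMCriticalPt`, `localJoin_of_isMCriticalPt`) being
  inherited because a path that starts in a component stays in it.  (Milnor, *Morse theory*
  (1963), Thms. 3.1–3.2 and Remark 3.3: dually the manifold is `∂M × I` with handles of index
  `≥ 2` attached, whose attaching spheres are connected, so `π₀(∂M) → π₀(M)` is a bijection.)
* `RegularSublevel.connectedSpace_of_two_le_morseIndex` — **for a Morse function `φ` on a
  closed connected manifold of dimension `≥ 2` and a regular level `b` above which every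
  critical point has index `≥ 2`, the sublevel set `{φ ≤ b}` is connected** (if nonempty):
  were `{φ ≤ b} = A ⊔ B`, connectedness of the whole manifold would produce a component of the
  superlevel set `{b ≤ φ}` adhering to both `A` and `B`, i.e. with disconnected boundary,
  contradicting the first theorem for the adapted Morse function `b - φ + 1` on `{b ≤ φ}`
  (`RegularSublevel.morseData`; indices turn about, `IsMorse.morseIndex_const_sub_add`).
  `RegularSublevel.connectedSpace_superlevel_of_morseIndex_add_two_le` is the turned-about twin:
  if every critical point below `b` has coindex `≥ 2` then `{b ≤ φ}` is connected.  In
  dimension `3` the two together say that **both halves of an ordered Heegaard function are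
  connected** — the form used for Gay–Kirby's `H₁₂`, `H₃₁` (and then
  `TrisectionsHandleCounts.lean` normalises their handle counts to `(1, g)`).

## References

* D. Gay, R. Kirby, *Trisecting 4-manifolds*, Geom. Topol. 20 (2016) 3097–3132, §4, Lemma 14
  and its proof ("`H₃₁`, `H₁₂` are genus `g` handlebodies"). [GayKirby2016]
* J. Milnor, *Morse theory* (1963), Thms. 3.1–3.2, Remark 3.3. [Milnor1963]
* A. Juhász, *Differential and Low-Dimensional Topology* (2023), §3.5 and Def. 3.27 (Heegaard
  surfaces are connected). [Juhasz2023]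
-/

open scoped Manifold ContDiff Topology
open Set Function Filter

noncomputable section

universe u

namespace Literature.Topology.FourManifolds

/-! ### Components of a manifold with handles of coindex `≥ 2` have connected boundary -/

section Component

variable {n : ℕ} {H : Type*} [TopologicalSpace H]
  {I : ModelWithCorners ℝ (EuclideanSpace ℝ (Fin (n + 1))) H}
  {M : Type*} [TopologicalSpace M] [ChartedSpace H M] [IsManifold I ∞ M]

omit [IsManifold I ∞ M] in
/-- For a Morse function adapted to the boundary, `f ≤ 1` everywhere. [cite: Milnor1963, §3] -/
private theorem IsMorseAdapted.adapted_le_one {f : M → ℝ} (hf : IsMorseAdapted I f) (x : M) : f x ≤ 1 := by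
  rcases I.isInteriorPoint_or_isBoundaryPoint x with h | h
  · exact (hf.2.2 x h).le
  · exact (hf.2.1 x h).1.le

omit [IsManifold I ∞ M] in
/-- For a Morse function adapted to the boundary, the boundary is the top level `f⁻¹(1)`.
[cite: Milnor1963, §3] -/
private theorem IsMorseAdapted.adapted_boundary_eq_preimage {f : M → ℝ} (hf : IsMorseAdapted I f) :
    I.boundary M = f ⁻¹' {1} := by
  ext x
  constructor
  · intro hx
    exact (hf.2.1 x hx).1
  · intro hx
    by_contra hb
    have hi : I.IsInteriorPoint x := (I.isInteriorPoint_iff_not_isBoundaryPoint x).2 hb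
    exact (hf.2.2 x hi).ne hx

omit [IsManifold I ∞ M] in
/-- Points strictly below the top level are interior points. [cite: Milnor1963, §3] -/
private theorem IsMorseAdapted.adapted_isInteriorPoint_of_lt_one {f : M → ℝ} (hf : IsMorseAdapted I f) {x : M}
    (hx : f x < 1) : I.IsInteriorPoint x := by
  rcases I.isInteriorPoint_or_isBoundaryPoint x with h | h
  · exact h
  · exact absurd (hf.2.1 x h).1 hx.ne

/-- **Every component of a compact manifold carrying an adapted Morse function without
critical points of coindex `≤ 1` meets the boundary in a preconnected set.**  Let `M` be a
compact smooth `(n+1)`-manifold with boundary over a slice model (`n ≥ 1`), `f` a Morse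
function adapted to `∂M` all of whose interior critical points have index `λ` with
`λ + 2 ≤ n + 1`, and `C` the connected component of a point.  Then `C ∩ ∂M` is preconnected:
`C` is open and closed (manifolds are locally path connected), hence a compact connected
locally path-connected space on which `f ≤ 1` with `f⁻¹(1) = C ∩ ∂M`; at interior points the
local joining conditions of `isPreconnected_preimage_top_of_joinedIn` hold in `M`
(`localJoin_of_not_isMCriticalPt`, `localJoin_of_isMCriticalPt`) and are inherited by `C`,
because the joining paths start in `C` and therefore stay in the component `C`.  For connected
`M` this is the tree's `IsMorseAdapted.isPreconnected_boundary_and_nonempty` (F2a: the boundary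
of a handlebody is connected).  Milnor 1963, Thms. 3.1–3.2 with Remark 3.3 (handles of index
`≥ 2` of `1 - f` have connected attaching spheres). [cite: Milnor1963, Thms. 3.1–3.2 and Remark 3.3] -/
theorem IsMorseAdapted.isPreconnected_connectedComponent_inter_boundary [SliceModel I] [T2Space M]
    [CompactSpace M] [LocallyPathConnectedSpace M] {f : M → ℝ} (hf : IsMorseAdapted I f)
    (hidx : ∀ x, I.IsInteriorPoint x → IsMCriticalPt I f x → morseIndex I f x + 2 ≤ n + 1)
    (x₀ : M) : IsPreconnected (connectedComponent x₀ ∩ I.boundary M) := by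
  set C : Set M := connectedComponent x₀ with hC
  have hCo : IsOpen C := isOpen_connectedComponent
  have hCc : IsClosed C := isClosed_connectedComponent
  -- the component as a compact connected locally path-connected space
  haveI : CompactSpace C := isCompact_iff_compactSpace.1 hCc.isCompact
  haveI : ConnectedSpace C := isConnected_iff_connectedSpace.1 isConnected_connectedComponent
  haveI : LocallyPathConnectedSpace C := hCo.locallyPathConnectedSpace
  have hcont : Continuous f := hf.1.1.continuous
  set g : C → ℝ := fun x => f x.1 with hg
  have hgc : Continuous g := hcont.comp continuous_subtype_val
  have hg1 : ∀ x : C, g x ≤ 1 := fun x => hf.adapted_le_one x.1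
  -- the local data in `M`
  have hLH : ∀ x : M, f x < 1 → (x ∈ closure {y | f x < f y} ∧
      ∀ N ∈ 𝓝 x, ∃ U ∈ 𝓝 x, U ⊆ N ∧
        ∀ p ∈ U, ∀ q ∈ U, f x < f p → f x < f q → JoinedIn {y | f x < f y} p q) := by
    intro x hx
    have hint := hf.adapted_isInteriorPoint_of_lt_one hx
    by_cases hc : IsMCriticalPt I f x
    · exact localJoin_of_isMCriticalPt hf.1 hint hc (hidx x hint hc)
    · exact localJoin_of_not_isMCriticalPt hf.1.1 hint hc
  -- transported to the component
  have hcl : ∀ x : C, g x < 1 → x ∈ closure {y : C | g x < g y} := by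
    intro x hx
    have h1 : x.1 ∈ closure {y : M | f x.1 < f y} := (hLH x.1 hx).1
    have h2 : x.1 ∈ closure (C ∩ {y : M | f x.1 < f y}) :=
      hCo.inter_closure ⟨x.2, h1⟩
    rw [Topology.IsInducing.subtypeVal.closure_eq_preimage_closure_image]
    refine (closure_mono ?_) h2
    rintro y ⟨hyC, hy⟩
    exact ⟨⟨y, hyC⟩, hy, rfl⟩
  have hloc : ∀ x : C, g x < 1 → ∀ N ∈ 𝓝 x, ∃ U ∈ 𝓝 x, U ⊆ N ∧
      ∀ p ∈ U, ∀ q ∈ U, g x < g p → g x < g q → JoinedIn {y : C | g x < g y} p q := by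
    intro x hx N hN
    -- a neighbourhood in `M` whose trace on `C` lies in `N`
    rw [nhds_subtype_eq_comap, Filter.mem_comap] at hN
    obtain ⟨N', hN', hN'N⟩ := hN
    obtain ⟨U, hU, hUN, hjoin⟩ := (hLH x.1 hx).2 (N' ∩ C) (inter_mem hN' (hCo.mem_nhds x.2))
    refine ⟨Subtype.val ⁻¹' U, ?_, fun p hp => hN'N ((hUN hp).1), fun p hp q hq hxp hxq => ?_⟩
    · rw [nhds_subtype_eq_comap]
      exact Filter.preimage_mem_comap hU
    obtain ⟨γ, hγ⟩ := hjoin p.1 hp q.1 hq hxp hxq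
    -- the path stays in the component `C`
    have hrange : range γ ⊆ C := by
      have hpc : IsPreconnected (range γ) := (isConnected_range γ.continuous).isPreconnected
      have hsub := hpc.subset_connectedComponent (x := p.1) ⟨0, γ.source⟩
      have hp2 : (p : M) ∈ connectedComponent x₀ := p.2
      have heq : connectedComponent (p : M) = connectedComponent x₀ :=
        (connectedComponent_eq hp2).symm
      intro z hz
      have hz' := hsub hz
      rw [heq] at hz'
      exact hz'
    refine ⟨⟨⟨fun t => ⟨γ t, hrange ⟨t, rfl⟩⟩, ?_⟩, ?_, ?_⟩, fun t => hγ t⟩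
    · exact γ.continuous.subtype_mk _
    · exact Subtype.ext γ.source
    · exact Subtype.ext γ.target
  have hpre : IsPreconnected (g ⁻¹' {1}) := isPreconnected_preimage_top_of_joinedIn hgc hg1 hcl hloc
  -- back to `M`
  have himage : Subtype.val '' (g ⁻¹' {1}) = C ∩ I.boundary M := by
    rw [hf.adapted_boundary_eq_preimage]
    ext y
    constructor
    · rintro ⟨x, hx, rfl⟩
      exact ⟨x.2, hx⟩
    · rintro ⟨hyC, hy⟩
      exact ⟨⟨y, hyC⟩, hy, rfl⟩
  rw [← himage]
  exact hpre.image _ continuous_subtype_val.continuousOn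

/-- A predicate constant on connected components defines an open-and-closed set (components
of a locally connected space are open). [folklore] -/
theorem isClopen_setOf_of_connectedComponent [LocallyConnectedSpace M] {P : M → Prop}
    (hP : ∀ x y, y ∈ connectedComponent x → (P x ↔ P y)) : IsClopen {x | P x} := by
  have hopen : ∀ Q : M → Prop, (∀ x y, y ∈ connectedComponent x → (Q x ↔ Q y)) →
      IsOpen {x | Q x} := by
    intro Q hQ
    rw [isOpen_iff_mem_nhds]
    intro x hx
    exact Filter.mem_of_superset (isOpen_connectedComponent.mem_nhds mem_connectedComponent)
      fun y hy => (hQ x y hy).1 hx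
  refine ⟨?_, hopen P hP⟩
  have h := hopen (fun x => ¬ P x) fun x y hy => not_congr (hP x y hy)
  rw [← isOpen_compl_iff]
  exact h

end Component

/-! ### Sublevel and superlevel sets of Morse functions on closed manifolds -/

section Closed

variable {k : ℕ} {Y : Type u} [TopologicalSpace Y] [T2Space Y]
  [CompactSpace Y] [ConnectedSpace Y] [ChartedSpace (EuclideanSpace ℝ (Fin (k + 1))) Y]
  [IsManifold (𝓡 (k + 1)) ∞ Y] {φ : Y → ℝ} {b : ℝ}

/-- **The sublevel set below the `2`-handles is connected.**  Let `φ` be a Morse function on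
a closed connected manifold `Y` of dimension `k + 1 ≥ 2` and `b` a level through no critical
point such that every critical point `z` with `b ≤ φ z` has index `≥ 2`.  If `{φ ≤ b}` is
nonempty, the regular sublevel set `{φ ≤ b}` (`Literature.Topology.FourManifolds.RegularSublevel`)
is connected.  Proof: if `{φ ≤ b} = A ⊔ B` with `A`, `B` closed and nonempty, then, `Y`
being connected, some connected component `C` of the superlevel set `{b ≤ φ}` meets both `A`
and `B`, necessarily along the level `{φ = b} = ∂{b ≤ φ}`; but `{b ≤ φ}` carries the adapted
Morse function `b - φ + 1` whose critical points have index `(k + 1) - index ≤ k - 1`, so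
`C ∩ ∂{b ≤ φ}` is connected (`IsMorseAdapted.isPreconnected_connectedComponent_inter_boundary`)
— a contradiction.  (Milnor 1963, Thms. 3.1–3.2 and Remark 3.3: `{φ ≤ b'}` is obtained from
`{φ ≤ b}` by attaching handles of index `≥ 2`, which does not change `π₀`, and `{φ ≤ max} = Y`
is connected.)  For Gay–Kirby's Lemma 14 this gives the connectedness of the handlebody
`H₁₂ = {φ ≤ b}` of an ordered Heegaard function with several minima.
[cite: Milnor1963, Thms. 3.1–3.2 and Remark 3.3] [cite: GayKirby2016, §4, proof of Lemma 14] -/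
theorem RegularSublevel.connectedSpace_of_two_le_morseIndex [NeZero k] (hφ : IsMorse (𝓡 (k + 1)) φ)
    (h : IsRegularLevel (𝓡 (k + 1)) φ b)
    (hidx : ∀ z, IsMCriticalPt (𝓡 (k + 1)) φ z → b ≤ φ z → 2 ≤ morseIndex (𝓡 (k + 1)) φ z)
    (hne : ∃ y, φ y ≤ b) : ConnectedSpace (RegularSublevel h) := by
  -- the superlevel set as a manifold with boundary and its adapted Morse function
  set M : Type u := RegularSuperlevel h with hM
  haveI : LocallyPathConnectedSpace M :=
    ChartedSpace.locallyPathConnectedSpace (EuclideanHalfSpace (k + 1)) M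
  obtain ⟨hψ, hcrit, hind⟩ := RegularSublevel.morseData (hφ.const_sub b) h.const_sub
  set ι : M → Y := RegularSublevel.incl h.const_sub with hι
  have hιc : Continuous ι := RegularSublevel.continuous_incl h.const_sub
  have hιinj : Injective ι := RegularSublevel.injective_incl h.const_sub
  set ψ : M → ℝ := fun x => (fun y => b - φ y) (ι x) + (1 - 0) with hψdef
  have hrank : Module.finrank ℝ (EuclideanSpace ℝ (Fin (k + 1))) = k + 1 := finrank_euclideanSpace_fin
  have hidxψ : ∀ x : M, (𝓡∂ (k + 1)).IsInteriorPoint x → IsMCriticalPt (𝓡∂ (k + 1)) ψ x →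
      morseIndex (𝓡∂ (k + 1)) ψ x + 2 ≤ k + 1 := by
    intro x _ hx
    have hx' : IsMCriticalPt (𝓡 (k + 1)) (fun y => b - φ y) (ι x) := (hcrit x).1 hx
    have hd : MDifferentiableAt (𝓡 (k + 1)) 𝓘(ℝ, ℝ) φ (ι x) :=
      hφ.contMDiff.mdifferentiableAt (by simp)
    have hxφ : IsMCriticalPt (𝓡 (k + 1)) φ (ι x) := (isMCriticalPt_const_sub_iff b hd).1 hx'
    have hsum := hφ.morseIndex_const_sub_add b hxφ
    rw [hrank] at hsum
    have hge : b ≤ φ (ι x) := sub_nonpos.1 (RegularSublevel.apply_incl_le h.const_sub x)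
    have h2 := hidx (ι x) hxφ hge
    rw [hind x hx']
    omega
  have hcomp : ∀ x₀ : M, IsPreconnected (connectedComponent x₀ ∩ (𝓡∂ (k + 1)).boundary M) :=
    fun x₀ => hψ.isPreconnected_connectedComponent_inter_boundary hidxψ x₀
  -- membership in the level through `ι`
  have hlevel : ∀ x : M, x ∈ (𝓡∂ (k + 1)).boundary M ↔ φ (ι x) = b := fun x => by
    rw [RegularSublevel.mem_boundary_iff h.const_sub x]
    constructor
    · intro hx; have : b - φ (ι x) = 0 := hx; linarith
    · intro hx; show b - φ (ι x) = 0; linarith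
  have hrangeι : ∀ y, b ≤ φ y → ∃ x : M, ι x = y := fun y hy =>
    ⟨RegularSublevel.mk h.const_sub y (sub_nonpos.2 hy), rfl⟩
  -- the sublevel set
  set S : Set Y := φ ⁻¹' Iic b with hS
  have hSc : IsClosed S := isClosed_Iic.preimage hφ.contMDiff.continuous
  suffices hpc : IsPreconnected S by
    obtain ⟨y, hy⟩ := hne
    exact isConnected_iff_connectedSpace.1 ⟨⟨y, hy⟩, hpc⟩
  rw [isPreconnected_iff_subset_of_disjoint_closed]
  intro u v hu hv huv hdisj
  by_contra hcon
  rcases not_or.1 hcon with ⟨hSu, hSv⟩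
  -- `A = S ∩ u`, `B = S ∩ v`: closed, disjoint, nonempty, covering `S`
  obtain ⟨a₀, ha₀S, ha₀u⟩ := not_subset.1 hSv
  obtain ⟨b₀, hb₀S, hb₀v⟩ := not_subset.1 hSu
  have ha₀ : a₀ ∈ u := (huv ha₀S).resolve_right ha₀u
  have hb₀ : b₀ ∈ v := (huv hb₀S).resolve_left hb₀v
  have hAB : ∀ y, y ∈ S → y ∈ u → y ∈ v → False := fun y hyS hyu hyv => by
    have : y ∈ S ∩ (u ∩ v) := ⟨hyS, hyu, hyv⟩
    rw [hdisj] at this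
    exact this
  -- the predicate "the component of `x` adheres to `A`"
  set P : M → Prop := fun x => (ι '' connectedComponent x ∩ (S ∩ u)).Nonempty with hP
  have hPconst : ∀ x y : M, y ∈ connectedComponent x → (P x ↔ P y) := fun x y hy => by
    simp only [hP, connectedComponent_eq hy]
  have hPclopen : IsClopen {x | P x} := isClopen_setOf_of_connectedComponent hPconst
  -- if no component adheres to both `A` and `B`, `Y` splits
  by_cases hboth : ∃ x : M, P x ∧ (ι '' connectedComponent x ∩ (S ∩ v)).Nonempty
  swap
  · set A' : Set Y := (S ∩ u) ∪ ι '' {x | P x} with hA'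
    set B' : Set Y := (S ∩ v) ∪ ι '' {x | ¬ P x} with hB'
    have hA'c : IsClosed A' :=
      (hSc.inter hu).union ((hPclopen.1.isCompact.image hιc).isClosed)
    have hB'c : IsClosed B' :=
      (hSc.inter hv).union ((hPclopen.compl.1.isCompact.image hιc).isClosed)
    have hcover : univ ⊆ A' ∪ B' := by
      intro y _
      by_cases hy : φ y ≤ b
      · rcases huv hy with hyu | hyv
        · exact Or.inl (Or.inl ⟨hy, hyu⟩)
        · exact Or.inr (Or.inl ⟨hy, hyv⟩)
      · obtain ⟨x, rfl⟩ := hrangeι y (not_le.1 hy).le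
        by_cases hx : P x
        · exact Or.inl (Or.inr ⟨x, hx, rfl⟩)
        · exact Or.inr (Or.inr ⟨x, hx, rfl⟩)
    have hdisj' : univ ∩ (A' ∩ B') = ∅ := by
      rw [univ_inter]
      refine Set.eq_empty_of_forall_notMem fun y hy => ?_
      obtain ⟨hyA, hyB⟩ := hy
      rcases hyA with ⟨hyS, hyu⟩ | ⟨x, hx, rfl⟩
      · rcases hyB with ⟨-, hyv⟩ | ⟨x, hx, hxy⟩
        · exact hAB y hyS hyu hyv
        · exact hx ⟨y, ⟨⟨x, mem_connectedComponent, hxy⟩, hyS, hyu⟩⟩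
      · rcases hyB with ⟨hyS, hyv⟩ | ⟨x', hx', hx'y⟩
        · exact hboth ⟨x, hx, ι x, ⟨x, mem_connectedComponent, rfl⟩, hyS, hyv⟩
        · rw [hιinj hx'y] at hx'
          exact hx' hx
    rcases (isPreconnected_iff_subset_of_disjoint_closed.1 isPreconnected_univ) A' B' hA'c hB'c
      hcover hdisj' with hA | hB
    · -- `b₀ ∈ B` would lie in `A'`
      have hb₀A : b₀ ∈ A' := hA (mem_univ b₀)
      rcases hb₀A with ⟨-, hb₀u⟩ | ⟨x, hPx, hxb⟩
      · exact hAB b₀ hb₀S hb₀u hb₀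
      · exact hboth ⟨x, hPx, b₀, ⟨x, mem_connectedComponent, hxb⟩, hb₀S, hb₀⟩
    · have ha₀B : a₀ ∈ B' := hB (mem_univ a₀)
      rcases ha₀B with ⟨-, ha₀v⟩ | ⟨x, hx, hxa⟩
      · exact hAB a₀ ha₀S ha₀ ha₀v
      · exact hx ⟨a₀, ⟨x, mem_connectedComponent, hxa⟩, ha₀S, ha₀⟩
  -- a component adhering to both sides has disconnected trace on the level: contradiction
  obtain ⟨x₀, ⟨ya, ⟨xa, hxaC, rfl⟩, hyaS, hyau⟩, ⟨yb, ⟨xb, hxbC, rfl⟩, hybS, hybv⟩⟩ := hboth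
  set T : Set Y := ι '' (connectedComponent x₀ ∩ (𝓡∂ (k + 1)).boundary M) with hT
  have hTpc : IsPreconnected T := (hcomp x₀).image ι hιc.continuousOn
  have hTS : T ⊆ S := by
    rintro _ ⟨x, ⟨-, hx⟩, rfl⟩
    exact ((hlevel x).1 hx).le
  have hxa : ι xa ∈ T := ⟨xa, ⟨hxaC, (hlevel xa).2 (le_antisymm hyaS
    (sub_nonpos.1 (RegularSublevel.apply_incl_le h.const_sub xa)))⟩, rfl⟩
  have hxb : ι xb ∈ T := ⟨xb, ⟨hxbC, (hlevel xb).2 (le_antisymm hybS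
    (sub_nonpos.1 (RegularSublevel.apply_incl_le h.const_sub xb)))⟩, rfl⟩
  rcases (isPreconnected_iff_subset_of_disjoint_closed.1 hTpc) u v hu hv (hTS.trans huv)
    (by
      refine Set.eq_empty_of_forall_notMem fun y hy => ?_
      exact hAB y (hTS hy.1) hy.2.1 hy.2.2) with hTu | hTv
  · exact hAB _ hybS (hTu hxb) hybv
  · exact hAB _ hyaS hyau (hTv hxa)

/-- **The superlevel set above the `(dim - 2)`-handles is connected** (the previous theorem
for the turned-about function `b - φ`, `IsMorse.criticalSetOfIndex_const_sub`): for a Morse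
function `φ` on a closed connected manifold of dimension `k + 1 ≥ 2` and a regular level `b`
below which every critical point has coindex `≥ 2` (`index + 2 ≤ k + 1`), the regular
superlevel set `{b ≤ φ}` is connected if nonempty.  In dimension `3`: if all critical points
below `b` have index `≤ 1` then `{b ≤ φ}` is connected — the handlebody `H₃₁` of an ordered
Heegaard function (Gay–Kirby 2016, proof of Lemma 14).
[cite: Milnor1963, Thms. 3.1–3.2 and Remark 3.3] [cite: GayKirby2016, §4, proof of Lemma 14] -/
theorem RegularSublevel.connectedSpace_superlevel_of_morseIndex_add_two_le [NeZero k]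
    (hφ : IsMorse (𝓡 (k + 1)) φ) (h : IsRegularLevel (𝓡 (k + 1)) φ b)
    (hidx : ∀ z, IsMCriticalPt (𝓡 (k + 1)) φ z → φ z ≤ b →
      morseIndex (𝓡 (k + 1)) φ z + 2 ≤ k + 1)
    (hne : ∃ y, b ≤ φ y) : ConnectedSpace (RegularSuperlevel h) := by
  have hrank : Module.finrank ℝ (EuclideanSpace ℝ (Fin (k + 1))) = k + 1 := finrank_euclideanSpace_fin
  refine RegularSublevel.connectedSpace_of_two_le_morseIndex (hφ.const_sub b) h.const_sub
    (fun z hz hz0 => ?_) ?_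
  · have hd : MDifferentiableAt (𝓡 (k + 1)) 𝓘(ℝ, ℝ) φ z := hφ.contMDiff.mdifferentiableAt (by simp)
    have hzφ : IsMCriticalPt (𝓡 (k + 1)) φ z := (isMCriticalPt_const_sub_iff b hd).1 hz
    have hsum := hφ.morseIndex_const_sub_add b hzφ
    rw [hrank] at hsum
    have := hidx z hzφ (sub_nonneg.1 hz0)
    omega
  · obtain ⟨y, hy⟩ := hne
    exact ⟨y, sub_nonpos.2 hy⟩

end Closed

end Literature.Topology.FourManifolds

end
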